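import Literature.NumberTheory.Automorphic.QuaternionRamificationParity
import Literature.NumberTheory.QuadraticForms.HilbertReciprocityRat
import HarnessLib

/-!
# Rational quaternion algebras are ramified at an even number of places

Topic `NumberTheory/Automorphic`; namespace `Literature.Automorphic`. Discharge of the named fact
`even_card_ramified` of `QuaternionAlgebraAdelic.lean` (Vignéras, LNM 800, Ch. III §3 Thm. 3.1:
the number of ramified places, finite and infinite, of a quaternion algebra over a number field
is even) in the case `K = ℚ`: combine the reduction to Hilbert reciprocity
(`even_card_ramified_of_hilbertReciprocity`, `QuaternionRamificationParity.lean`) with Hilbert's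
reciprocity law over `ℚ` (`hilbertReciprocity_rat`, `QuadraticForms/HilbertReciprocityRat.lean`;
Serre, *A Course in Arithmetic*, Ch. III Thm. 3). For a general number field the remaining input
is the product formula half of the named fact `hilbertReciprocity` (quadratic class field theory).

## References

* M.-F. Vignéras, *Arithmétique des algèbres de quaternions*, LNM 800 (1980), Ch. III §3 Thm. 3.1.
* J.-P. Serre, *A Course in Arithmetic*, GTM 7 (1973), Ch. III §2.1 Thm. 3.
-/

noncomputable section

universe u

namespace Literature.NumberTheory.Automorphic

/-- **Parity of ramification for rational quaternion algebras** (Vignéras, LNM 800, Ch. III §3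
Thm. 3.1 for `K = ℚ`; classically Hilbert): a quaternion algebra `D` over `ℚ` is ramified at an
even number of places (finite and infinite) — the named fact `even_card_ramified ℚ D`, proved from
`even_card_ramified_of_hilbertReciprocity` and Hilbert reciprocity over `ℚ`
(`hilbertReciprocity_rat`). [cite: VignerasLNM800, Ch. III §3 Thm. 3.1] -/
theorem even_card_ramified_rat (D : Type u) [Ring D] [Algebra ℚ D] : even_card_ramified ℚ D :=
  even_card_ramified_of_hilbertReciprocity ℚ D QuadraticForms.hilbertReciprocity_rat

end Literature.NumberTheory.Automorphic
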